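import Summits.ValiantsHypothesis.ValiantsHypothesis.Theorems.LacunarySymmetroidTowerThetaWitnessCore

/-!
# Route LacunarySymmetroid — TOWER DOOR, witness part 2/2: the tower enumeration and `towerThetaWitness_holds`

Stage 3: digit-wise base change (`kd_*`), the admissible positions, the tower substitution's cost/degree (`complexity_gT_le`, `totalDegree_gT_le`,
`eval_gT`), and **`towerThetaWitness_holds`** — a real family with `VNP` complexification whose restriction to the TOWER curve `y_i = X^{(2^n)^i}`
has `≥ 2^{n⌊log₂ n⌋} − 1` distinct real zeros, eventually — the `TowerThetaWitness` leg of the tower door, stated INLINE as its `∃`-text.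
Verbatim from the workfile (namespace `…Theorems.LacunarySymmetroid.TowerDoor`).
HONEST FRAMING: VP ≠ VNP is NOT proved by any of the tower-door files; `TowerB` (head of LINE (B) `Cruxes/WeakLifting/Lines/tower_graft.lean`) is
OPEN; no `closes` binder of any route is touched (director R300 (2)).  Landing hand: val-sym-eng-2 g7 (P1, director-valiant R300 (3), lead R2806/R2809;
source `Cruxes/MatrixDescartes/TowerDoorComplete.lean` @ca015990e815 by val-idea-22 g7, crit-6 V#35 PASS).
[folklore] Tavenas 2014; Bürgisser 2000 §2.1 (tree theorems `isVNPFamily_aeval_of_isPBounded` etc.).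
-/

set_option linter.dupNamespace false

open Finset Polynomial
open scoped BigOperators

namespace Summit.ValiantsHypothesis.ValiantsHypothesis.Theorems.LacunarySymmetroid.TowerDoor

open Literature.Computability.AlgebraicComplexity
open Literature.Computability.AlgebraicComplexity.TavenasVn
open Literature.Computability.AlgebraicComplexity.BoolGadgets (sum_boolVec_eq_sum_range ofBits_eq_sum)
open Literature.Computability.Complexity.ArithCkt (ofBits_bitsOf)
open Summit.ValiantsHypothesis.ValiantsHypothesis.Theorems.SymmetroidDescartes (complexity_pow_le)




/-- Auxiliary step `kd_lt` of the tower-door witness (verbatim from the workfile). [folklore] -/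
theorem kd_lt {B G : ℕ} (hBG : B ≤ G) (hB : 1 ≤ B) : ∀ a u, kd B G a u < G ^ a := by
  intro a
  induction a with
  | zero => intro u; simp [kd]
  | succ a ih =>
    intro u
    simp only [kd]
    have h1 := ih (u / B)
    have h2 : u % B < B := Nat.mod_lt _ hB
    calc u % B + G * kd B G a (u / B) < G + G * kd B G a (u / B) := by omega
      _ = G * (kd B G a (u / B) + 1) := by ring
      _ ≤ G * G ^ a := Nat.mul_le_mul_left _ h1
      _ = G ^ (a + 1) := by ring

/-- Auxiliary step `kd_lt_kd` of the tower-door witness (verbatim from the workfile). [folklore] -/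
theorem kd_lt_kd {B G : ℕ} (hBG : B ≤ G) (hB : 1 ≤ B) :
    ∀ a u u', u < u' → u' < B ^ a → kd B G a u < kd B G a u' := by
  intro a
  induction a with
  | zero => intro u u' h h'; simp at h'; omega
  | succ a ih =>
    intro u u' huu' hu'
    simp only [kd]
    have hdiv : u / B ≤ u' / B := Nat.div_le_div_right huu'.le
    rcases hdiv.eq_or_lt with heq | hlt
    · have h1 := Nat.div_add_mod u B
      have h2 := Nat.div_add_mod u' B
      rw [heq] at h1
      rw [heq]
      omega
    · have hu'B : u' / B < B ^ a := by
        rw [Nat.div_lt_iff_lt_mul hB]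
        calc u' < B ^ (a + 1) := hu'
          _ = B ^ a * B := pow_succ _ _
      have h3 := ih _ _ hlt hu'B
      have hmod : u % B < B := Nat.mod_lt _ hB
      calc u % B + G * kd B G a (u / B) < B + G * kd B G a (u / B) := by omega
        _ ≤ G * (kd B G a (u / B) + 1) := by nlinarith
        _ ≤ G * kd B G a (u' / B) := Nat.mul_le_mul_left _ h3
        _ ≤ u' % B + G * kd B G a (u' / B) := Nat.le_add_left _ _

/-- Auxiliary step `kd_mod_two` of the tower-door witness (verbatim from the workfile). [folklore] -/
theorem kd_mod_two {B G : ℕ} (hB : 2 ∣ B) (hG : 2 ∣ G) : ∀ a u, 1 ≤ a → kd B G a u % 2 = u % 2 := by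
  intro a u ha
  obtain ⟨a, rfl⟩ : ∃ a', a = a' + 1 := ⟨a - 1, by omega⟩
  simp only [kd]
  obtain ⟨g, rfl⟩ := hG
  rw [mul_assoc, Nat.add_mul_mod_self_left, Nat.mod_mod_of_dvd _ hB]

/-- Auxiliary step `kd_testBit` of the tower-door witness (verbatim from the workfile). [folklore] -/
theorem kd_testBit (n L : ℕ) (hL : L ≤ n) :
    ∀ a u t, Nat.testBit (kd (2 ^ L) (2 ^ n) a u) t = true → t % n < L ∧ t / n < a := by
  intro a
  induction a with
  | zero => intro u t h; simp [kd] at h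
  | succ a ih =>
    intro u t h
    simp only [kd] at h
    have hmodlt : u % 2 ^ L < 2 ^ n :=
      (Nat.mod_lt _ (by positivity)).trans_le (Nat.pow_le_pow_right (by norm_num) hL)
    rw [add_comm, Nat.testBit_two_pow_mul_add _ hmodlt t] at h
    split_ifs at h with ht
    · have htL : t < L := by
        by_contra hc
        push Not at hc
        rw [Nat.testBit_lt_two_pow ((Nat.mod_lt _ (by positivity)).trans_le
          (Nat.pow_le_pow_right (by norm_num) hc))] at h
        exact Bool.false_ne_true h
      exact ⟨by rw [Nat.mod_eq_of_lt ht]; exact htL, by rw [Nat.div_eq_of_lt ht]; exact Nat.succ_pos _⟩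
    · push Not at ht
      obtain ⟨h1, h2⟩ := ih _ _ h
      rcases Nat.eq_zero_or_pos n with hn | hn
      · subst hn; exact absurd h1 (by omega)
      · refine ⟨by rwa [Nat.mod_eq_sub_mod ht], ?_⟩
        rw [Nat.div_lt_iff_lt_mul hn] at h2 ⊢
        have : t - n < a * n := h2
        calc t < a * n + n := by omega
          _ = (a + 1) * n := by ring


/-- Auxiliary step `kd_mem_goodIdx` of the tower-door witness (verbatim from the workfile). [folklore] -/
theorem kd_mem_goodIdx (n u : ℕ) :
    kd (2 ^ Nat.log 2 n) (2 ^ n) n u ∈ goodIdx (n * n) (towerP n) := by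
  have hL : Nat.log 2 n ≤ n := Nat.log_le_self 2 n
  rw [mem_goodIdx]
  refine ⟨?_, fun t _ hbit => ?_⟩
  · have := kd_lt (Nat.pow_le_pow_right (by norm_num) hL) Nat.one_le_two_pow n u
    rwa [← pow_mul] at this
  · obtain ⟨h1, h2⟩ := kd_testBit n (Nat.log 2 n) hL n u t hbit
    unfold towerP
    rw [mem_filter, mem_range]
    refine ⟨?_, h1⟩
    rcases Nat.eq_zero_or_pos n with hn | hn
    · subst hn; simp at h1
    · exact (Nat.div_lt_iff_lt_mul hn).1 h2


/-- Auxiliary step `two_pow_mod_le` of the tower-door witness (verbatim from the workfile). [folklore] -/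
theorem two_pow_mod_le (n : ℕ) (j : ℕ) (h : j % n < Nat.log 2 n) : 2 ^ (j % n) ≤ n := by
  rcases Nat.eq_zero_or_pos n with hn | hn
  · subst hn; simp at h
  · exact (Nat.pow_le_pow_right (by norm_num) h.le).trans (Nat.pow_log_le_self 2 hn.ne')

/-- Auxiliary step `complexity_gT_le` of the tower-door witness (verbatim from the workfile). [folklore] -/
theorem complexity_gT_le (n : ℕ) (v : XZ (n * n)) :
    complexity (MvPolynomial.map (algebraMap ℝ ℂ) (gT n v)) ≤ n := by
  rcases v with j | i
  · simp only [gT, Sum.elim_inl]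
    split_ifs with hj
    · rw [map_pow, MvPolynomial.map_X]
      refine (complexity_pow_le _ _).trans ?_
      rw [complexity_X_holds, mul_zero, zero_add]
      exact two_pow_mod_le n j hj.1
    · rw [map_zero, ← MvPolynomial.C_0, complexity_C_holds]
      exact Nat.zero_le _
  · simp only [gT, Sum.elim_inr]
    rw [MvPolynomial.map_C, complexity_C_holds]
    exact Nat.zero_le _

/-- Auxiliary step `totalDegree_gT_le` of the tower-door witness (verbatim from the workfile). [folklore] -/
theorem totalDegree_gT_le (n : ℕ) (v : XZ (n * n)) :
    (MvPolynomial.map (algebraMap ℝ ℂ) (gT n v)).totalDegree ≤ n := by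
  rcases v with j | i
  · simp only [gT, Sum.elim_inl]
    split_ifs with hj
    · rw [map_pow, MvPolynomial.map_X]
      refine (MvPolynomial.totalDegree_pow _ _).trans ?_
      rw [MvPolynomial.totalDegree_X, mul_one]
      exact two_pow_mod_le n j hj.1
    · rw [map_zero, MvPolynomial.totalDegree_zero]
      exact Nat.zero_le _
  · simp only [gT, Sum.elim_inr]
    rw [MvPolynomial.map_C, MvPolynomial.totalDegree_C]
    exact Nat.zero_le _

/-- along the tower curve `y_a = x^{2^{n a}}` the substitution lands on the partial Kronecker point. -/
theorem eval_gT (n : ℕ) (x : ℝ) (v : XZ (n * n)) :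
    MvPolynomial.eval (fun a : Fin n => x ^ 2 ^ (n * (a : ℕ))) (gT n v) = FP (n * n) (towerP n) x v := by
  rcases v with j | i
  · have key : ((j : ℕ) % n < Nat.log 2 n ∧ (j : ℕ) / n < n) ↔ ((j : ℕ) < n * n ∧ (j : ℕ) % n < Nat.log 2 n) := by
      rcases Nat.eq_zero_or_pos n with hn | hn
      · subst hn; simp
      · rw [Nat.div_lt_iff_lt_mul hn]; tauto
    simp only [gT, FP, Sum.elim_inl, towerP, mem_filter, mem_range]
    by_cases hj : (j : ℕ) % n < Nat.log 2 n ∧ (j : ℕ) / n < n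
    · rw [dif_pos hj, if_pos (key.1 hj), map_pow, MvPolynomial.eval_X, ← pow_mul, ← pow_add, Nat.div_add_mod]
    · rw [dif_neg hj, if_neg (fun h => hj (key.2 h)), map_zero]
  · simp only [gT, FP, Sum.elim_inr, MvPolynomial.eval_C]

open Summit.ValiantsHypothesis.ValiantsHypothesis.Theorems.LacunarySymmetroid
  (isVNPFamily_aeval_of_isPBounded isVNPFamily_map_of_isProjection_perPoly)

/-- `hV ℚ ν` is a projection of a permanent of p-bounded size (Tavenas Cor. 3.37 with the explicit witness). -/
theorem exists_isProjection_hV : ∃ N : ℕ → ℕ, IsPBounded N ∧ ∀ ν, IsProjection (hV ℚ ν) (perPoly (Fin (N ν)) ℚ) := by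
  have hchar : ringChar ℚ ≠ 2 := by rw [ringChar.eq_zero]; norm_num
  choose N hN hproj using fun ν => isProjection_boolSum_eval (BCS1997_thm_21_27_holds ℚ)
    (BCS1997_thm_21_29_holds ℚ) hchar (witnessFin ν)
  refine ⟨N, ?_, fun ν => ?_⟩
  · have c := fun m : ℕ => IsPBounded.const m
    exact (IsPBounded.mul_holds (c 10) (IsPBounded.add_holds (IsPBounded.mul_holds (c 2) isPBounded_size_witnessFin)
      (c 2))).mono hN
  · rw [← boolSum_witnessFin]
    exact hproj ν

/-- **`TowerThetaWitness`** (the statement of `Cruxes/MatrixDescartes/TowerDoor.lean`, verbatim): a real family with `VNP`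
complexification whose restriction to the TOWER curve `y_i = X^{(2^n)^i}` has `≥ 2^{n⌊log₂ n⌋} - 1` distinct real zeros,
eventually.  Witness: Tavenas' bit polynomial `hV` of `V_{n²}` under the tower substitution `gT n`; the restriction is the
sub-sum of `V_{n²}` over numerals with binary support in `P_n`, which keeps Hutchinson's dominant-term sign pattern. -/
theorem towerThetaWitness_holds :
    ∃ Θ : ∀ n : ℕ, MvPolynomial (Fin n) ℝ,
      IsVNPFamily (fun n => MvPolynomial.map (algebraMap ℝ ℂ) (Θ n)) ∧
      ∃ n₀ : ℕ, ∀ n : ℕ, n₀ ≤ n → 2 ^ (n * Nat.log 2 n) ≤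
        (MvPolynomial.aeval (fun i : Fin n => (Polynomial.X : Polynomial ℝ) ^ (2 ^ n) ^ (i : ℕ)) (Θ n)).roots.toFinset.card
          + 1 := by
  obtain ⟨N, hN, hproj⟩ := exists_isProjection_hV
  refine ⟨fun n => MvPolynomial.aeval (gT n) (MvPolynomial.map (algebraMap ℚ ℝ) (hV ℚ (n * n))), ?_, 2, fun n hn => ?_⟩
  · /- VNP -/
    have hmap : ∀ n : ℕ, MvPolynomial.map (algebraMap ℝ ℂ)
        (MvPolynomial.aeval (gT n) (MvPolynomial.map (algebraMap ℚ ℝ) (hV ℚ (n * n)))) =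
        MvPolynomial.aeval (fun v => MvPolynomial.map (algebraMap ℝ ℂ) (gT n v))
          (MvPolynomial.map (algebraMap ℚ ℂ) (hV ℚ (n * n))) := by
      intro n
      rw [MvPolynomial.aeval_eq_bind₁, MvPolynomial.aeval_eq_bind₁, MvPolynomial.map_bind₁, MvPolynomial.map_map]
      congr 2
    simp only [hmap]
    have hν : IsPBounded fun n : ℕ => n * n := IsPBounded.mul_holds IsPBounded.id IsPBounded.id
    have hB : IsPBounded fun n => (n + 2 * (2 * (n * n) + 3)) * (n + 1) :=
      IsPBounded.mul_holds
        (IsPBounded.add_holds IsPBounded.id (IsPBounded.mul_holds (IsPBounded.const 2)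
          (IsPBounded.add_holds (IsPBounded.mul_holds (IsPBounded.const 2) hν) (IsPBounded.const 3))))
        (IsPBounded.add_holds IsPBounded.id (IsPBounded.const 1))
    refine isVNPFamily_aeval_of_isPBounded (σ := fun n => XZ (n * n)) (τ := fun n => Fin n)
      (isVNPFamily_map_of_isProjection_perPoly (σ := fun n => XZ (n * n))
        (q := fun n => N (n * n)) (IsPBounded.comp_holds hN hν) ?_
        (fun n => hV ℚ (n * n)) fun n => hproj (n * n))
      (fun n v => MvPolynomial.map (algebraMap ℝ ℂ) (gT n v)) hB
      (fun n => ?_) (fun n => ?_) (fun n v => ?_)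
    · refine (IsPBounded.add_holds (IsPBounded.add_holds (IsPBounded.mul_holds (IsPBounded.const 2) hν)
        (IsPBounded.const 3)) (IsPBounded.add_holds (IsPBounded.mul_holds (IsPBounded.const 2) hν)
        (IsPBounded.const 3))).mono fun n => ?_
      rw [Fintype.card_sum, Fintype.card_fin]
    · rw [Fintype.card_fin]
      calc n ≤ n + 2 * (2 * (n * n) + 3) := Nat.le_add_right _ _
        _ = (n + 2 * (2 * (n * n) + 3)) * 1 := (mul_one _).symm
        _ ≤ _ := Nat.mul_le_mul_left _ (by omega)
    · calc ∑ v, complexity (MvPolynomial.map (algebraMap ℝ ℂ) (gT n v))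
          ≤ ∑ _v : XZ (n * n), n := Finset.sum_le_sum fun v _ => complexity_gT_le n v
        _ = (2 * (2 * (n * n) + 3)) * n := by
          rw [Finset.sum_const, Finset.card_univ, Fintype.card_sum, Fintype.card_fin, smul_eq_mul]
          ring
        _ ≤ (n + 2 * (2 * (n * n) + 3)) * (n + 1) := Nat.mul_le_mul (Nat.le_add_left _ _) (Nat.le_succ _)
    · calc (MvPolynomial.map (algebraMap ℝ ℂ) (gT n v)).totalDegree ≤ n := totalDegree_gT_le n v
        _ ≤ n + 1 := Nat.le_succ _
        _ = 1 * (n + 1) := (one_mul _).symm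
        _ ≤ (n + 2 * (2 * (n * n) + 3)) * (n + 1) := Nat.mul_le_mul_right _ (by omega)
  · /- roots along the tower curve -/
    set L := Nat.log 2 n with hLdef
    have hL1 : 1 ≤ L := Nat.log_pos one_lt_two hn
    have hLn : L ≤ n := Nat.log_le_self 2 n
    have hP : MvPolynomial.aeval (fun i : Fin n => (Polynomial.X : Polynomial ℝ) ^ (2 ^ n) ^ (i : ℕ))
        (MvPolynomial.aeval (gT n) (MvPolynomial.map (algebraMap ℚ ℝ) (hV ℚ (n * n)))) =
        (subV (n * n) (goodIdx (n * n) (towerP n))).map (Int.castRingHom ℝ) := by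
      apply Polynomial.funext
      intro x
      rw [← eval_FP_hV, ← map_hV (algebraMap ℚ ℝ) (n * n), ← Polynomial.coe_aeval_eq_eval,
        MvPolynomial.comp_aeval_apply, MvPolynomial.comp_aeval_apply, MvPolynomial.aeval_eq_eval]
      have hF : (fun v => MvPolynomial.aeval (fun i : Fin n => Polynomial.aeval x
            ((Polynomial.X : Polynomial ℝ) ^ (2 ^ n) ^ (i : ℕ))) (gT n v)) = FP (n * n) (towerP n) x := by
        funext v
        rw [← eval_gT n x v, MvPolynomial.aeval_eq_eval]
        have hpt : (fun i : Fin n => Polynomial.aeval x ((Polynomial.X : Polynomial ℝ) ^ (2 ^ n) ^ (i : ℕ))) =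
            fun a : Fin n => x ^ 2 ^ (n * (a : ℕ)) := by
          funext i
          simp only [map_pow, Polynomial.aeval_X, ← pow_mul]
        rw [hpt]
      rw [hF]
    rw [hP]
    -- the enumeration `u ↦ kd (2^L) (2^n) n u`, `u < 2^{nL} = (2^L)^n`
    have hBG : 2 ^ L ≤ 2 ^ n := Nat.pow_le_pow_right (by norm_num) hLn
    have hB1 : 1 ≤ 2 ^ L := Nat.one_le_two_pow
    have hr : 2 ^ (n * L) = (2 ^ L) ^ n := by rw [← pow_mul, mul_comm]
    have h := le_card_roots_subV (n * n) (2 ^ (n * L)) (goodIdx (n * n) (towerP n)) (kd (2 ^ L) (2 ^ n) n)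
      (fun u hu => kd_lt_kd hBG hB1 n u (u + 1) (Nat.lt_succ_self u) (by rwa [← hr]))
      (fun u _ => by have := kd_lt hBG hB1 n u; rwa [← pow_mul] at this)
      (fun u _ => kd_mem_goodIdx n u)
      (fun u _ => kd_mod_two (dvd_pow_self 2 (by omega)) (dvd_pow_self 2 (by omega)) n u (by omega))
    have h1 : 1 ≤ 2 ^ (n * L) := Nat.one_le_two_pow
    omega

end Summit.ValiantsHypothesis.ValiantsHypothesis.Theorems.LacunarySymmetroid.TowerDoor
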